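import Summits.CriticalPhenomena.Ising3DConformalLimit.Theorems.HyperoctahedralRPInversionUpgradeNormalisedCrossPairingBound
import Summits.CriticalPhenomena.Ising3DConformalLimit.Theorems.HyperoctahedralRPInversionUpgradeNormalisedOddOddDecay
import Summits.CriticalPhenomena.Ising3DConformalLimit.Theorems.HyperoctahedralRPInversionUpgradeNormalisedClusteringOfOddOddDecay
import Summits.CriticalPhenomena.Ising3DConformalLimit.Theorems.HyperoctahedralRPInversionUpgradeNormalisedGaussianDomination
import Summits.CriticalPhenomena.Ising3DConformalLimit.Theorems.HyperoctahedralRPInversionUpgradeNormalisedPairTruncation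
import HarnessLib

/-!
# `stub_clustering` — STUB 6 of item stmt-CriticalPhenomena-1982's registered line `free-endpoint-gaussian-closure`
(skeleton `Cruxes/InversionUpgradeNormalised/Lines/free-endpoint-gaussian-closure.lean`, sha 046034fc1267), PROVED;
also the derived stub of line `Sketch` v4 for crux stmt-CriticalPhenomena-1344 `MoebiusLimitExists`
(`Cruxes/MoebiusLimitExists/Lines/Sketch.lean`, lead c11).

CLUSTERING (OS4) of every normalised, non-degenerate, Euclidean-invariant, scale-covariant pointwise scaling limit
`S` of the critical `ℤ³` Ising correlators, in every direction `v ≠ 0`: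

  `S_{n+m}(x, y + t v) - S_n(x) S_m(y) → 0` as `t → ∞`,

given (as hypotheses, both LANDED theorems of 1982's line: `stub_gaussianDomination` p75645,
`stub_pairTruncation` p76600) Gaussian domination and the two-sided Glimm–Jaffe pair truncation in the limit.
The proof is the composition of the three pieces landed by the lead's wave 1 (2026-08-17):
`stub_crossPairingBound` (p139062: parity lemma with a price — an odd block forces a cross pair in every Wick
ordering, so `pairingSum ≤ (2k)! M^(k-1) ε`), `stub_oddOddDecay` (p139228: odd|odd blocks decay,
`S_{n+m}(x, y+tv) → 0` for odd `n, m`, via Gaussian domination, `S₂ = C‖·‖^{-2Δ}`, `Δ ≥ 1/2`) and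
`stub_clustering_of_oddOddDecay` (p139161: parity/injectivity bookkeeping + pair truncation + squeeze).
With this file SIX of the seven stubs of 1982's line are theorems; the residue is `stub_interiorInversionUpgrade`
(the inversion upgrade on the interacting stratum with OS along three axes, clustering and the sharp window free).
-/

noncomputable section

open Filter Topology
open Literature.Probability.LatticeModels

namespace Summit.CriticalPhenomena.Ising3DConformalLimit.Cruxes.InversionUpgradeNormalised.FreeEndpointGaussianClosure

/-- **STUB 6 `stub_clustering` of line `free-endpoint-gaussian-closure` (item stmt-1982), VERBATIM — PROVED.**
Given Gaussian domination and pair truncation in the limit: clustering `S_{n+m}(x, y + t v) - S_n(x) S_m(y) → 0`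
(`t → ∞`, `v ≠ 0`) for every normalised, non-degenerate, Euclidean-invariant, scale-covariant pointwise limit of
`criticalCorr 3`. Composition of `stub_crossPairingBound`, `stub_oddOddDecay`, `stub_clustering_of_oddOddDecay`.
[cite: GlimmJaffe1987, Cor. 4.3.3 and §19.3] -/
theorem stub_clustering :
    (∀ (ρ : ℝ → ℝ) (S : CorrFamily 3), (∀ δ ∈ Set.Ioc (0:ℝ) 1, 0 < ρ δ) →
      HasPointwiseScalingLimit (criticalCorr 3) ρ S →
      ∀ (n : ℕ) (x : Fin (2 * n) → EuclideanSpace ℝ (Fin 3)), x ∈ NonCoincident 3 (2 * n) →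
        S (2 * n) x ≤ pairingSum (fun a b => S 2 ![a, b]) n x) →
    (∀ (ρ : ℝ → ℝ) (S : CorrFamily 3), (∀ δ ∈ Set.Ioc (0:ℝ) 1, 0 < ρ δ) →
      HasPointwiseScalingLimit (criticalCorr 3) ρ S →
      ∀ (p q : ℕ) (x : Fin p → EuclideanSpace ℝ (Fin 3)) (y : Fin q → EuclideanSpace ℝ (Fin 3)),
        Even p → Even q → Function.Injective (Fin.append x y) →
        0 ≤ S (p + q) (Fin.append x y) - S p x * S q y ∧
        2 * (S (p + q) (Fin.append x y) - S p x * S q y) ≤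
          ∑ I ∈ (Finset.univ : Finset (Fin p)).powerset.filter (fun I => Odd I.card),
            ∑ J ∈ (Finset.univ : Finset (Fin q)).powerset.filter (fun J => Odd J.card),
              S (I.card + J.card)
                  (Fin.append (fun i => x (I.orderEmbOfFin rfl i)) (fun j => y (J.orderEmbOfFin rfl j))) *
                S (Iᶜ.card + Jᶜ.card)
                  (Fin.append (fun i => x (Iᶜ.orderEmbOfFin rfl i)) (fun j => y (Jᶜ.orderEmbOfFin rfl j)))) →
    ∀ (ρ : ℝ → ℝ) (Δ : ℝ) (S : CorrFamily 3), (∀ δ ∈ Set.Ioc (0:ℝ) 1, 0 < ρ δ) →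
      HasPointwiseScalingLimit (criticalCorr 3) ρ S → (∀ n z, z ∉ NonCoincident 3 n → S n z = 0) →
      IsNondegenerateTwoPoint S → IsEuclideanInvariant S → IsScaleCovariant Δ S →
      ∀ (n m : ℕ) (x : Fin n → EuclideanSpace ℝ (Fin 3)) (y : Fin m → EuclideanSpace ℝ (Fin 3))
        (v : EuclideanSpace ℝ (Fin 3)), v ≠ 0 →
        Tendsto (fun t : ℝ => S (n + m) (Fin.append x (fun j => y j + t • v)) - S n x * S m y)
          atTop (𝓝 0) :=
  fun hGD hPT => stub_clustering_of_oddOddDecay (stub_oddOddDecay stub_crossPairingBound hGD) hPT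

/-- **Clustering, hypothesis-free form**: the two hypotheses of `stub_clustering` are the landed theorems
`stub_gaussianDomination` (p75645) and `stub_pairTruncation` (p76600), so every normalised, non-degenerate,
Euclidean-invariant, scale-covariant pointwise scaling limit of `criticalCorr 3` clusters in every direction.
[cite: GlimmJaffe1987, §19.3] -/
theorem clustering_of_limit
    {ρ : ℝ → ℝ} {Δ : ℝ} {S : CorrFamily 3} (hρ : ∀ δ ∈ Set.Ioc (0:ℝ) 1, 0 < ρ δ)
    (hlim : HasPointwiseScalingLimit (criticalCorr 3) ρ S) (hnorm : ∀ n z, z ∉ NonCoincident 3 n → S n z = 0)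
    (hnd : IsNondegenerateTwoPoint S) (heuc : IsEuclideanInvariant S) (hsc : IsScaleCovariant Δ S)
    (n m : ℕ) (x : Fin n → EuclideanSpace ℝ (Fin 3)) (y : Fin m → EuclideanSpace ℝ (Fin 3))
    {v : EuclideanSpace ℝ (Fin 3)} (hv : v ≠ 0) :
    Tendsto (fun t : ℝ => S (n + m) (Fin.append x (fun j => y j + t • v)) - S n x * S m y) atTop (𝓝 0) :=
  stub_clustering stub_gaussianDomination stub_pairTruncation ρ Δ S hρ hlim hnorm hnd heuc hsc n m x y v hv

end Summit.CriticalPhenomena.Ising3DConformalLimit.Cruxes.InversionUpgradeNormalised.FreeEndpointGaussianClosure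

end
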